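import Summits.AtomisticToContinuum.Crystallization.Theorems.ThreeConeCertificateExactCertificateNoGapNecessary
import Summits.AtomisticToContinuum.Crystallization.Theorems.ThreeConeCertificateExactCertificateClosure

/-!
# `ExactCertificate` (stmt-AtomisticToContinuum-11959), line `closure-makes-nogap-exact`:
# the crux is EQUIVALENT to `stub_noGap ∧ stub_periodicMinimum`

Support file for the crux `ThreeConeCertificate.ExactCertificate` (line lead).  With the closure
stub landed (`…ExactCertificateClosure`, `stub_closure`) and the necessity file
(`…NoGapNecessary`), the line's composition is made a theorem of the tree:

* `split_of_twoSlack` — normal form: a radial positive-type `f` below `V_LJ` beyond `ρ` whose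
  tail slack `f 0 + 2e_Q(f·1_{<ρ}) + 2e_Q(V_LJ·1_{≥ρ})` is `≤ ε` and whose core remainder
  `(V_LJ − f)·1_{(0,ρ)}` has `Q` as an `ε`-approximate per-particle ground state yields a range-`ρ`
  split `IsSplit ρ c g U f` of value `c + f 0/2 ≤ −e(Q) + 3ε/2`;
* `exactCertificate_of_noGap_of_periodicMinimum` — no gap at `ρ₀` (registered signature of
  `stub_noGap`) + closure at level `−e*` + weak duality + a periodic minimiser (registered
  signature of `stub_periodicMinimum`) ⇒ `ExactCertificate`;
* **`exactCertificate_iff_noGap_and_periodicMinimum`** — together with `…NoGapNecessary`: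
  `ExactCertificate ↔ stub_noGap ∧ stub_periodicMinimum`.
* `noGapAt_iff_nearOptimal`, `nearOptimal_iff_sharpAt`, **`noGap_iff_sharpSplit`** — the no-gap stub
  is exactly `SharpSplit`: `∃ ρ c g U f, IsSplit ρ c g U f ∧ c + f 0/2 = −e*` (template- and `ε`-free),
  by the two weak dualities (`tailSlack_nonneg`, `const_le_energyPerParticle_of_stable`) and closure;
  hence **`exactCertificate_iff_sharpSplit_and_periodicMinimum`**.

So the crux factors exactly into the no-gap statement at a finite range (sharpness of the
three-cone bound, `P`-free up to `ε`) and attainment of the periodic infimum (= item 11961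
`KeplerBound`).  All `[folklore]`; the glue is adapted from the line skeleton
`Cruxes/ExactCertificate/Lines/closure_makes_nogap_exact.lean` (planner, cruxplan seat).
-/

noncomputable section

namespace Summit.AtomisticToContinuum.Crystallization.Theorems.ThreeConeCertificateExactCertificate.NoGap

open Literature.MathematicalPhysics.StatisticalMechanics
open Summit.AtomisticToContinuum.Crystallization.Theses.ThreeConeCertificate
open Summit.AtomisticToContinuum.Crystallization.Theorems.ChargedEnergyGapNegative
  (E3 eStar eStar_le)
open Summit.AtomisticToContinuum.Crystallization.Theorems.ExactCertificateNegative
  (IsSplit exactCertificate_iff)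
open Summit.AtomisticToContinuum.Crystallization.Theorems.ThreeConeCertificateExactCertificate.Slackness
  (summable_of_finRange energyPerParticle_congr_points noGap_of_exactCertificate
    periodicMinimum_of_exactCertificate energyPerParticle_add core_eq_zero summable_core
    energyPerParticle_split_range tailSlack_nonneg const_le_energyPerParticle_of_stable stable_core
    interactionEnergy_mono_pos)
open scoped BigOperators

/-! ## Lattice-sum accounting for truncated potentials -/

/-- The energy per particle is odd in the potential (no summability needed). [folklore] -/
theorem energyPerParticle_neg (Q : PeriodicConfiguration 3) (W : ℝ → ℝ) :
    Q.energyPerParticle (fun r => -W r) = -Q.energyPerParticle W := by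
  unfold PeriodicConfiguration.energyPerParticle
  rw [← mul_neg, ← Finset.sum_neg_distrib]
  congr 1
  exact Finset.sum_congr rfl fun x _ => tsum_neg

/-- `e_Q((V_LJ − f)·1_{(0,ρ)}) = e_Q(V_LJ·1_{(0,ρ)}) − e_Q(f·1_{(0,ρ)})` (finite sums). [folklore] -/
theorem energyPerParticle_core_sub (Q : PeriodicConfiguration 3) (ρ : ℝ) (f : ℝ → ℝ) :
    Q.energyPerParticle (fun r => if r < ρ then lennardJones r - f r else 0) =
      Q.energyPerParticle (fun r => if r < ρ then lennardJones r else 0) -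
        Q.energyPerParticle (fun r => if r < ρ then f r else 0) := by
  have h₁ : ∀ x ∈ Q.motif, Summable fun q : {y : E3 // y ∈ Q.points ∧ y ≠ x} =>
      (if dist x q.1 < ρ then lennardJones (dist x q.1) else 0) := fun x _ =>
    summable_core Q ρ lennardJones x
  have h₂ : ∀ x ∈ Q.motif, Summable fun q : {y : E3 // y ∈ Q.points ∧ y ≠ x} =>
      (if dist x q.1 < ρ then -f (dist x q.1) else 0) := fun x _ =>
    summable_core Q ρ (fun s => -f s) x
  have hadd := energyPerParticle_add Q (W₁ := fun r => if r < ρ then lennardJones r else 0)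
    (W₂ := fun r => if r < ρ then -f r else 0) h₁ h₂
  have hneg : Q.energyPerParticle (fun r => if r < ρ then -f r else 0) =
      -Q.energyPerParticle (fun r => if r < ρ then f r else 0) :=
    (energyPerParticle_congr_points Q (V := fun r => if r < ρ then -f r else 0)
      (W := fun r => -(if r < ρ then f r else 0)) fun p _ q _ _ => by
        show (if dist p q < ρ then -f (dist p q) else 0) = -(if dist p q < ρ then f (dist p q) else 0)
        split_ifs <;> simp).trans (energyPerParticle_neg Q _)
  have hlhs : Q.energyPerParticle (fun r => if r < ρ then lennardJones r - f r else 0) =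
      Q.energyPerParticle (fun r => (fun r => if r < ρ then lennardJones r else 0) r +
        (fun r => if r < ρ then -f r else 0) r) :=
    energyPerParticle_congr_points Q fun p _ q _ _ => by
      show (if dist p q < ρ then lennardJones (dist p q) - f (dist p q) else 0) =
        (if dist p q < ρ then lennardJones (dist p q) else 0) + (if dist p q < ρ then -f (dist p q) else 0)
      split_ifs <;> ring
  rw [hlhs, hadd, hneg, ← sub_eq_add_neg]

/-! ## The normal-form split and the composition -/

/-- **Normal form.**  A radial positive-type `f` below `V_LJ` beyond `ρ`, whose core remainder
`g_f = (V_LJ − f)·1_{(0,ρ)}` has `Q` as an `ε`-approximate per-particle ground state and whose tail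
slack is `≤ ε`, yields a range-`ρ` split of value `≤ −e_LJ(Q) + 3ε/2`:
`g := g_f`, `U := (V_LJ − f)·1_{[ρ,∞)}`, `c := ε − e_Q(g_f)`. [folklore] -/
theorem split_of_twoSlack (Q : PeriodicConfiguration 3) (ρ ε : ℝ) (f : ℝ → ℝ)
    (hpd : ∀ (n : ℕ) (y : Fin n → E3) (w : Fin n → ℝ), 0 ≤ ∑ i, ∑ j, w i * w j * f (dist (y i) (y j)))
    (htail : ∀ r : ℝ, ρ ≤ r → 0 < r → f r ≤ lennardJones r)
    (hT : f 0 + 2 * Q.energyPerParticle (fun r => if r < ρ then f r else 0)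
          + 2 * Q.energyPerParticle (fun r => if r < ρ then 0 else lennardJones r) ≤ ε)
    (hC : ∀ (N : ℕ) (x : Fin N → E3), Function.Injective x →
        (N : ℝ) * (Q.energyPerParticle (fun r => if r < ρ then lennardJones r - f r else 0) - ε) ≤
          interactionEnergy (fun r => if r < ρ then lennardJones r - f r else 0) x) :
    ∃ (c : ℝ) (g U : ℝ → ℝ), IsSplit ρ c g U f ∧
      c + f 0 / 2 ≤ -(Q.energyPerParticle lennardJones) + 3 * ε / 2 := by
  set eg : ℝ := Q.energyPerParticle (fun r => if r < ρ then lennardJones r - f r else 0) with heg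
  refine ⟨ε - eg, fun r => if r < ρ then lennardJones r - f r else 0,
    fun r => if r < ρ then 0 else lennardJones r - f r, ⟨?_, ?_, ?_, hpd, ?_⟩, ?_⟩
  · intro r _
    show lennardJones r =
      (if r < ρ then lennardJones r - f r else 0) + (if r < ρ then 0 else lennardJones r - f r) + f r
    by_cases h : r < ρ
    · rw [if_pos h, if_pos h]; ring
    · rw [if_neg h, if_neg h]; ring
  · intro r hr
    show 0 ≤ (if r < ρ then 0 else lennardJones r - f r)
    by_cases h : r < ρ
    · rw [if_pos h]
    · rw [if_neg h, sub_nonneg]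
      exact htail r (not_lt.1 h) hr
  · intro r hr
    show (if r < ρ then lennardJones r - f r else 0) = 0
    rw [if_neg (not_lt.2 hr)]
  · intro N x hx
    have h1 := hC N x hx
    have e1 : -((ε - eg) * (N : ℝ)) = (N : ℝ) * (eg - ε) := by ring
    rw [e1]
    exact h1
  · -- lattice-sum accounting: value = CoreSlack + ½·TailSlack − e(Q)
    have hV := energyPerParticle_split_range Q ρ
    have hg : eg = Q.energyPerParticle (fun r => if r < ρ then lennardJones r else 0) -
          Q.energyPerParticle (fun r => if r < ρ then f r else 0) := by
      rw [heg]
      exact energyPerParticle_core_sub Q ρ f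
    linarith

/-- From no gap at `ρ₀`: near-optimal splits at range `ρ₀` relative to the floor `−e*`
(`P`-free). [folklore] -/
theorem noGapAt_of_twoSlack {ρ₀ : ℝ}
    (h : ∀ ε : ℝ, 0 < ε → ∃ (Q : PeriodicConfiguration 3) (f : ℝ → ℝ),
      (∀ (n : ℕ) (y : Fin n → E3) (w : Fin n → ℝ), 0 ≤ ∑ i, ∑ j, w i * w j * f (dist (y i) (y j))) ∧
      (∀ r : ℝ, ρ₀ ≤ r → 0 < r → f r ≤ lennardJones r) ∧
      f 0 + 2 * Q.energyPerParticle (fun r => if r < ρ₀ then f r else 0)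
          + 2 * Q.energyPerParticle (fun r => if r < ρ₀ then 0 else lennardJones r) ≤ ε ∧
      (∀ (N : ℕ) (x : Fin N → E3), Function.Injective x →
        (N : ℝ) * (Q.energyPerParticle (fun r => if r < ρ₀ then lennardJones r - f r else 0) - ε) ≤
          interactionEnergy (fun r => if r < ρ₀ then lennardJones r - f r else 0) x)) :
    ∀ ε : ℝ, 0 < ε → ∃ (c : ℝ) (g U f : ℝ → ℝ), IsSplit ρ₀ c g U f ∧ c + f 0 / 2 ≤ -eStar + ε := by
  intro ε hε
  obtain ⟨Q, f, hpd, htail, hT, hC⟩ := h (ε / 2) (by positivity)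
  obtain ⟨c, g, U, hs, hv⟩ := split_of_twoSlack Q ρ₀ (ε / 2) f hpd htail hT hC
  refine ⟨c, g, U, f, hs, ?_⟩
  have hQ := eStar_le Q
  linarith

/-- **SUFFICIENCY: no gap at some range + a periodic minimiser ⇒ `ExactCertificate`.**  No gap ⇒
near-optimal splits at `ρ₀`; the closure lemma (`stub_closure`, landed) at level `−e*` ⇒ a split of
value `≤ −e*`; weak duality ⇒ `= −e*`; the minimiser `P` has `e(P) = e*`; hence the crux with (S6)
as an equation.  (Hypotheses = the registered signatures of `stub_noGap`, `stub_periodicMinimum`.)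
[folklore] -/
theorem exactCertificate_of_noGap_of_periodicMinimum
    (hng : ∃ ρ₀ : ℝ, ∀ ε : ℝ, 0 < ε → ∃ (Q : PeriodicConfiguration 3) (f : ℝ → ℝ),
      (∀ (n : ℕ) (y : Fin n → EuclideanSpace ℝ (Fin 3)) (w : Fin n → ℝ),
        0 ≤ ∑ i, ∑ j, w i * w j * f (dist (y i) (y j))) ∧
      (∀ r : ℝ, ρ₀ ≤ r → 0 < r → f r ≤ lennardJones r) ∧
      f 0 + 2 * Q.energyPerParticle (fun r => if r < ρ₀ then f r else 0) +
          2 * Q.energyPerParticle (fun r => if r < ρ₀ then 0 else lennardJones r) ≤ ε ∧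
      (∀ (N : ℕ) (x : Fin N → EuclideanSpace ℝ (Fin 3)), Function.Injective x →
        (N : ℝ) * (Q.energyPerParticle (fun r => if r < ρ₀ then lennardJones r - f r else 0) - ε) ≤
          interactionEnergy (fun r => if r < ρ₀ then lennardJones r - f r else 0) x))
    (hP : ∃ P : PeriodicConfiguration 3, ∀ Q : PeriodicConfiguration 3,
      P.energyPerParticle lennardJones ≤ Q.energyPerParticle lennardJones) :
    ExactCertificate := by
  obtain ⟨ρ₀, hng⟩ := hng
  have hN := noGapAt_of_twoSlack hng
  obtain ⟨c, g, U, f, hS, hv⟩ :=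
    Summit.AtomisticToContinuum.Crystallization.Theorems.ThreeConeCertificateExactCertificate.stub_closure
      ρ₀ (-eStar) hN
  have hs : IsSplit ρ₀ c g U f := hS
  have hge := hs.value_ge
  obtain ⟨P, hP⟩ := hP
  have heP : P.energyPerParticle lennardJones = eStar :=
    le_antisymm (le_ciInf hP) (eStar_le P)
  obtain ⟨h1, h2, h3, h4, h5⟩ := hS
  refine ⟨P, ρ₀, c, g, U, f, h1, h2, h3, h4, h5, ?_⟩
  rw [heP]
  linarith

/-- **THE LINE IS AN EQUIVALENCE: `ExactCertificate ↔ stub_noGap ∧ stub_periodicMinimum`**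
(registered signatures verbatim): the crux factors exactly into "no three-cone duality gap at some
finite range" (`P`-free up to `ε`) and "the periodic infimum of `e_LJ` is attained" (= item 11961
`KeplerBound`). [folklore] -/
theorem exactCertificate_iff_noGap_and_periodicMinimum :
    ExactCertificate ↔
      ((∃ ρ₀ : ℝ, ∀ ε : ℝ, 0 < ε → ∃ (Q : PeriodicConfiguration 3) (f : ℝ → ℝ),
        (∀ (n : ℕ) (y : Fin n → EuclideanSpace ℝ (Fin 3)) (w : Fin n → ℝ),
          0 ≤ ∑ i, ∑ j, w i * w j * f (dist (y i) (y j))) ∧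
        (∀ r : ℝ, ρ₀ ≤ r → 0 < r → f r ≤ lennardJones r) ∧
        f 0 + 2 * Q.energyPerParticle (fun r => if r < ρ₀ then f r else 0) +
            2 * Q.energyPerParticle (fun r => if r < ρ₀ then 0 else lennardJones r) ≤ ε ∧
        (∀ (N : ℕ) (x : Fin N → EuclideanSpace ℝ (Fin 3)), Function.Injective x →
          (N : ℝ) * (Q.energyPerParticle (fun r => if r < ρ₀ then lennardJones r - f r else 0) - ε) ≤
            interactionEnergy (fun r => if r < ρ₀ then lennardJones r - f r else 0) x)) ∧
      (∃ P : PeriodicConfiguration 3, ∀ Q : PeriodicConfiguration 3,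
        P.energyPerParticle lennardJones ≤ Q.energyPerParticle lennardJones)) :=
  ⟨fun h => ⟨noGap_of_exactCertificate h, periodicMinimum_of_exactCertificate h⟩,
    fun h => exactCertificate_of_noGap_of_periodicMinimum h.1 h.2⟩

/-! ## The no-gap statement IS `SharpSplit` (`P`-free, `ε`-free) -/

/-- At a fixed range `ρ₀`, the two-slack no-gap statement is equivalent to the existence of
near-optimal three-cone splits (value `≤ −e* + ε` for every `ε > 0`).  `→`: the normal form;
`←`: take an `ε/4`-optimal split and an `ε/4`-minimal periodic `Q`, keep the split's `f`; the tail
functional equals `f 0 + 2e_Q(V_LJ) − 2e_Q((V_LJ−f)1_{<ρ₀})`, the core constant is squeezed by the two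
weak dualities (`tailSlack_nonneg`, `const_le_energyPerParticle_of_stable`). [folklore] -/
theorem noGapAt_iff_nearOptimal (ρ₀ : ℝ) :
    (∀ ε : ℝ, 0 < ε → ∃ (Q : PeriodicConfiguration 3) (f : ℝ → ℝ),
      (∀ (n : ℕ) (y : Fin n → EuclideanSpace ℝ (Fin 3)) (w : Fin n → ℝ),
        0 ≤ ∑ i, ∑ j, w i * w j * f (dist (y i) (y j))) ∧
      (∀ r : ℝ, ρ₀ ≤ r → 0 < r → f r ≤ lennardJones r) ∧
      f 0 + 2 * Q.energyPerParticle (fun r => if r < ρ₀ then f r else 0) +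
          2 * Q.energyPerParticle (fun r => if r < ρ₀ then 0 else lennardJones r) ≤ ε ∧
      (∀ (N : ℕ) (x : Fin N → EuclideanSpace ℝ (Fin 3)), Function.Injective x →
        (N : ℝ) * (Q.energyPerParticle (fun r => if r < ρ₀ then lennardJones r - f r else 0) - ε) ≤
          interactionEnergy (fun r => if r < ρ₀ then lennardJones r - f r else 0) x)) ↔
    (∀ ε : ℝ, 0 < ε → ∃ (c : ℝ) (g U f : ℝ → ℝ), IsSplit ρ₀ c g U f ∧ c + f 0 / 2 ≤ -eStar + ε) := by
  refine ⟨noGapAt_of_twoSlack, fun h ε hε => ?_⟩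
  obtain ⟨c, g, U, f, hs, hv⟩ := h (ε / 4) (by positivity)
  have hlt : eStar < eStar + ε / 4 := by linarith
  obtain ⟨Q, hQ⟩ := exists_lt_of_ciInf_lt hlt
  set eg : ℝ := Q.energyPerParticle (fun r => if r < ρ₀ then lennardJones r - f r else 0) with heg
  -- stability of the core part and core weak duality: `−c ≤ e_Q(g_f)`
  have hst : ∀ (N : ℕ) (x : Fin N → E3), Function.Injective x →
      (-c) * N ≤ interactionEnergy (fun r => if r < ρ₀ then lennardJones r - f r else 0) x := by
    intro N x hx
    have := stable_core hs hx
    linarith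
  have hcore : -c ≤ eg :=
    const_le_energyPerParticle_of_stable Q (W := fun r => if r < ρ₀ then lennardJones r - f r else 0)
      (ρ := ρ₀) (fun r hr => by
        show (if r < ρ₀ then lennardJones r - f r else 0) = 0
        rw [if_neg (not_lt.2 hr)]) hst
  -- accounting and tail weak duality
  have hV := energyPerParticle_split_range Q ρ₀
  have hg : eg = Q.energyPerParticle (fun r => if r < ρ₀ then lennardJones r else 0) -
      Q.energyPerParticle (fun r => if r < ρ₀ then f r else 0) := by
    rw [heg]
    exact energyPerParticle_core_sub Q ρ₀ f
  have ht := tailSlack_nonneg Q (ρ := ρ₀) hs.posType (fun r hρ hr => hs.f_le_tail hρ hr)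
  refine ⟨Q, f, hs.posType, fun r hρ hr => hs.f_le_tail hρ hr, ?_, fun N x hx => ?_⟩
  · linarith [hcore, hV, hg, hv, hQ]
  · have h1 := hst N x hx
    have hN : (0 : ℝ) ≤ N := Nat.cast_nonneg N
    have h2 : eg + c ≤ ε := by linarith [ht, hV, hg, hv, hQ]
    nlinarith

/-- With the closure lemma (`stub_closure`, landed): near-optimal splits at `ρ₀` for every `ε` iff a
split at `ρ₀` attaining the floor `−e*` (weak duality `IsSplit.value_ge` gives `=`). [folklore] -/
theorem nearOptimal_iff_sharpAt (ρ₀ : ℝ) :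
    (∀ ε : ℝ, 0 < ε → ∃ (c : ℝ) (g U f : ℝ → ℝ), IsSplit ρ₀ c g U f ∧ c + f 0 / 2 ≤ -eStar + ε) ↔
      ∃ (c : ℝ) (g U f : ℝ → ℝ), IsSplit ρ₀ c g U f ∧ c + f 0 / 2 = -eStar := by
  constructor
  · intro h
    obtain ⟨c, g, U, f, hS, hv⟩ :=
      Summit.AtomisticToContinuum.Crystallization.Theorems.ThreeConeCertificateExactCertificate.stub_closure
        ρ₀ (-eStar) h
    have hs : IsSplit ρ₀ c g U f := hS
    exact ⟨c, g, U, f, hs, le_antisymm hv hs.value_ge⟩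
  · rintro ⟨c, g, U, f, hs, hv⟩ ε hε
    exact ⟨c, g, U, f, hs, by linarith⟩

/-- **`stub_noGap ↔ SharpSplit`**: the registered no-gap stub (signature verbatim) is exactly the
statement that SOME three-cone split of `V_LJ` at SOME finite range attains the value floor `−e*`
— template-free and `ε`-free. [folklore] -/
theorem noGap_iff_sharpSplit :
    (∃ ρ₀ : ℝ, ∀ ε : ℝ, 0 < ε → ∃ (Q : PeriodicConfiguration 3) (f : ℝ → ℝ),
      (∀ (n : ℕ) (y : Fin n → EuclideanSpace ℝ (Fin 3)) (w : Fin n → ℝ),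
        0 ≤ ∑ i, ∑ j, w i * w j * f (dist (y i) (y j))) ∧
      (∀ r : ℝ, ρ₀ ≤ r → 0 < r → f r ≤ lennardJones r) ∧
      f 0 + 2 * Q.energyPerParticle (fun r => if r < ρ₀ then f r else 0) +
          2 * Q.energyPerParticle (fun r => if r < ρ₀ then 0 else lennardJones r) ≤ ε ∧
      (∀ (N : ℕ) (x : Fin N → EuclideanSpace ℝ (Fin 3)), Function.Injective x →
        (N : ℝ) * (Q.energyPerParticle (fun r => if r < ρ₀ then lennardJones r - f r else 0) - ε) ≤
          interactionEnergy (fun r => if r < ρ₀ then lennardJones r - f r else 0) x)) ↔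
    ∃ (ρ c : ℝ) (g U f : ℝ → ℝ), IsSplit ρ c g U f ∧ c + f 0 / 2 = -eStar := by
  constructor
  · rintro ⟨ρ₀, h⟩
    exact ⟨ρ₀, (nearOptimal_iff_sharpAt ρ₀).1 ((noGapAt_iff_nearOptimal ρ₀).1 h)⟩
  · rintro ⟨ρ₀, hsh⟩
    exact ⟨ρ₀, (noGapAt_iff_nearOptimal ρ₀).2 ((nearOptimal_iff_sharpAt ρ₀).2 hsh)⟩

/-- **The factorisation in closed form: `ExactCertificate ↔ SharpSplit ∧ PeriodicMinimum`** — the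
crux is "some split attains the floor `−e*`" and "the periodic infimum `e*` is attained" (= item 11961
`KeplerBound`). [folklore] -/
theorem exactCertificate_iff_sharpSplit_and_periodicMinimum :
    ExactCertificate ↔
      (∃ (ρ c : ℝ) (g U f : ℝ → ℝ), IsSplit ρ c g U f ∧ c + f 0 / 2 = -eStar) ∧
      (∃ P : PeriodicConfiguration 3, ∀ Q : PeriodicConfiguration 3,
        P.energyPerParticle lennardJones ≤ Q.energyPerParticle lennardJones) :=
  exactCertificate_iff_noGap_and_periodicMinimum.trans (and_congr_left' noGap_iff_sharpSplit)

/-- **Registered stub `stub_iff` of the line `closure-makes-nogap-exact`** (signature verbatim):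
`ExactCertificate ↔ stub_noGap ∧ stub_periodicMinimum`. [folklore] -/
theorem stub_iff : ExactCertificate ↔
    (∃ ρ₀ : ℝ, ∀ ε : ℝ, 0 < ε → ∃ (Q : PeriodicConfiguration 3) (f : ℝ → ℝ),
      (∀ (n : ℕ) (y : Fin n → EuclideanSpace ℝ (Fin 3)) (w : Fin n → ℝ),
        0 ≤ ∑ i, ∑ j, w i * w j * f (dist (y i) (y j))) ∧
      (∀ r : ℝ, ρ₀ ≤ r → 0 < r → f r ≤ lennardJones r) ∧
      f 0 + 2 * Q.energyPerParticle (fun r => if r < ρ₀ then f r else 0) +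
          2 * Q.energyPerParticle (fun r => if r < ρ₀ then 0 else lennardJones r) ≤ ε ∧
      (∀ (N : ℕ) (x : Fin N → EuclideanSpace ℝ (Fin 3)), Function.Injective x →
        (N : ℝ) * (Q.energyPerParticle (fun r => if r < ρ₀ then lennardJones r - f r else 0) - ε) ≤
          interactionEnergy (fun r => if r < ρ₀ then lennardJones r - f r else 0) x)) ∧
    (∃ P : PeriodicConfiguration 3, ∀ Q : PeriodicConfiguration 3,
      P.energyPerParticle lennardJones ≤ Q.energyPerParticle lennardJones) :=
  exactCertificate_iff_noGap_and_periodicMinimum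

end Summit.AtomisticToContinuum.Crystallization.Theorems.ThreeConeCertificateExactCertificate.NoGap

end
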